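import Summits.QuantumAdvantage.QuantumAdvantage.Theorems.MobiusLadderLiouvilleOrthogonalTC0StubWindowAverage
import Summits.QuantumAdvantage.QuantumAdvantage.Theorems.MobiusLadderLiouvilleOrthogonalTC0StubAlignedBlocks
import Summits.QuantumAdvantage.QuantumAdvantage.Theorems.MobiusLadderLiouvilleOrthogonalTC0StubTopDigits
import HarnessLib

/-!
# Crux `MobiusLadder.LiouvilleOrthogonalTC0` (stmt-QuantumAdvantage-1393), line `Sketch`, skeleton v9.1:
stub `stub_topDigits_moebius` — `μ` is orthogonal to every Boolean function of the top digits

The Möbius twin of the landed top-digits rung `stub_topDigits` (Kalai's `TC⁰` conjecture is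
stated for `μ`). Let `ψ : ℕ → ℕ` be non-decreasing and unbounded. Then for every `ε > 0`,
eventually in `n`, for EVERY `G : ℕ → Bool`, `|Σ_{N < 2ⁿ} μ(N) · sgn G(⌊N / 2^{ψ n}⌋)| ≤ ε 2ⁿ`.

The two steps of the `λ`-rung (`stub_alignedBlocks`, `stub_topDigits`) are repeated here for a
general `1`-bounded summand `a : ℕ → ℝ` and then specialised to `a = μ`:
* `topDigitsMu_alignedBlocks_of` (twin of `stub_alignedBlocks`): if `a` has few bad short windows
  in the sense of the Matomäki–Radziwiłł theorem (hypothesis `hbad`) and its mean on `(X, 2X]`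
  tends to `0` (`hmean`), then for every scale `s j ≤ j`, `s j → ∞` and every `η > 0`,
  eventually in `j` the `2^{j - s j}` aligned blocks `B_i = [2^j + i 2^{s j}, 2^j + (i+1) 2^{s j})`
  tiling `[2^j, 2^{j+1})` satisfy `Σ_i |Σ_{B_i} a| ≤ η 2^j`: window averaging (the landed
  `stub_windowAverage` fed into `alignedBlocks_core`) with the window length `h = 2^{⌊s j/2⌋}`
  (`1 ≤ h ≤ 2^{s j}`, `h² ≤ 2^j`, `h · 2^{j - s j} · 2^{s j - ⌊s j/2⌋} = 2^j`) and `ε = η/16`.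
* `topDigitsMu_assembly` (twin of `stub_topDigits`): dyadic assembly — pick `L` with
  `2^{-L} < ε/4`, split `[0, 2ⁿ)` into the `2^{n-L}` lowest `N` (trivial bound `|a| ≤ 1`) and the
  generations `[2^j, 2^{j+1})`, `n - L ≤ j < n`, each tiled by the aligned blocks of scale
  `t = min (ψ j) j ≤ ψ n`, on which `⌊N / 2^{ψ n}⌋` is constant (`topDigits_div_const`), so that a
  generation contributes at most `(ε/2) 2^j` (`topDigitsMu_generation`) and the high part at most
  `(ε/2) 2ⁿ` (`topDigits_geom`).
For `a = μ` the two analytic inputs are the Matomäki–Radziwiłł theorem (tree, PROVED: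
`Literature.NumberTheory.Sieve.matomaki_radziwill_holds`; `μ` is real, multiplicative —
`ArithmeticFunction.isMultiplicative_moebius.intCast` — and `1`-bounded —
`ArithmeticFunction.abs_moebius_le_one`; `topDigitsMu_badCount`)
and the prime number theorem for `μ` (tree, PROVED:
`Literature.NumberTheory.LFunctions.abs_sum_moebius_le_logPow`; `topDigitsMu_mean`).
-/

set_option linter.dupNamespace false -- D-0017: single-problem summit ⇒ `QuantumAdvantage.QuantumAdvantage` by design

noncomputable section

namespace Summit.QuantumAdvantage.QuantumAdvantage.Theorems.LiouvilleOrthogonalTC0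

open Filter Finset Asymptotics
open Literature.Probability.RandomGraphs.LowDegree (sgn)
open Literature.NumberTheory.LFunctions (abs_sum_moebius_le_logPow)

/-- **Mean on `(X, 2X]` from an `x / log x` bound.** If `|Σ_{n ≤ x} a n| ≤ C x / log x` for all
`x ≥ 2`, then for every `δ > 0`, eventually in `X`, `|X⁻¹ Σ_{n ∈ (X, 2X]} a n| ≤ δ`
(split `(X, 2X] = (0, 2X] ∖ (0, X]` and take `log X ≥ 3C/δ`). -/
theorem topDigitsMu_mean_of (a : ℕ → ℝ)
    (hCx : ∃ C : ℝ, ∀ x : ℝ, 2 ≤ x → |∑ n ∈ Ioc 0 ⌊x⌋₊, a n| ≤ C * x / Real.log x ^ (1 : ℝ))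
    (δ : ℝ) (hδ : 0 < δ) :
    ∀ᶠ X : ℕ in atTop, |(X : ℝ)⁻¹ * ∑ n ∈ Ioc X (2 * X), a n| ≤ δ := by
  obtain ⟨C, hC⟩ := hCx
  have hC0 : 0 ≤ C := by
    have h2 := hC 2 le_rfl
    rw [Real.rpow_one] at h2
    have hl : 0 < Real.log 2 := Real.log_pos one_lt_two
    have h0 : (0 : ℝ) ≤ C * 2 / Real.log 2 := (abs_nonneg _).trans h2
    by_contra hneg
    push Not at hneg
    have : C * 2 / Real.log 2 < 0 := div_neg_of_neg_of_pos (by linarith) hl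
    linarith
  filter_upwards [eventually_ge_atTop 2,
    tendsto_natCast_atTop_atTop.eventually_ge_atTop (Real.exp (3 * C / δ))] with X hX2 hXexp
  have hXr : (2 : ℝ) ≤ X := by exact_mod_cast hX2
  have hX0 : (0 : ℝ) < X := by linarith
  have hlogX : 0 < Real.log X := Real.log_pos (by linarith)
  have hlog2X : Real.log X ≤ Real.log ((2 * X : ℕ) : ℝ) :=
    Real.log_le_log hX0 (by push_cast; linarith)
  have hA := hC (X : ℝ) hXr
  have hB := hC ((2 * X : ℕ) : ℝ) (by push_cast; linarith)
  rw [Nat.floor_natCast, Real.rpow_one] at hA hB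
  have hsplit := Finset.sum_Ioc_consecutive a (Nat.zero_le X) (by omega : X ≤ 2 * X)
  have hS : |∑ n ∈ Ioc X (2 * X), a n|
      ≤ C * ((2 * X : ℕ) : ℝ) / Real.log ((2 * X : ℕ) : ℝ) + C * X / Real.log X := by
    rw [eq_sub_of_add_eq' hsplit]
    exact (abs_sub _ _).trans (add_le_add hB hA)
  have hB' : C * ((2 * X : ℕ) : ℝ) / Real.log ((2 * X : ℕ) : ℝ)
      ≤ C * ((2 * X : ℕ) : ℝ) / Real.log X :=
    div_le_div_of_nonneg_left (by positivity) hlogX hlog2X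
  have hlogge : 3 * C / δ ≤ Real.log X := by
    have := Real.log_le_log (Real.exp_pos _) hXexp
    rwa [Real.log_exp] at this
  rw [abs_mul, abs_inv, Nat.abs_cast, inv_mul_le_iff₀ hX0]
  have h3 : 3 * C ≤ Real.log X * δ := by rwa [div_le_iff₀ hδ] at hlogge
  have h3X : (X : ℝ) * (3 * C) ≤ (X : ℝ) * (Real.log X * δ) := mul_le_mul_of_nonneg_left h3 hX0.le
  have key : C * ((2 * X : ℕ) : ℝ) / Real.log X + C * X / Real.log X ≤ X * δ := by
    rw [← add_div, div_le_iff₀ hlogX]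
    push_cast
    linarith
  linarith

/-- **The mean of `μ` on `(X, 2X]` tends to `0`** (prime number theorem for `μ`, tree:
`abs_sum_moebius_le_logPow` with `A = 1`): for every `δ > 0`, eventually in `X`,
`|X⁻¹ Σ_{n ∈ (X, 2X]} μ(n)| ≤ δ`. -/
theorem topDigitsMu_mean (δ : ℝ) (hδ : 0 < δ) :
    ∀ᶠ X : ℕ in atTop,
      |(X : ℝ)⁻¹ * ∑ n ∈ Ioc X (2 * X), ((ArithmeticFunction.moebius n : ℤ) : ℝ)| ≤ δ :=
  topDigitsMu_mean_of (fun n => ((ArithmeticFunction.moebius n : ℤ) : ℝ))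
    (abs_sum_moebius_le_logPow 1) δ hδ

/-- **Few bad windows for `μ`** (the Matomäki–Radziwiłł theorem, tree: `matomaki_radziwill_holds`,
applied to the real, multiplicative, `1`-bounded arithmetic function `μ`): for a window length
`w(X) → ∞` with `w(X) ≤ X` and `ε > 0`, the number of `x ∈ [X, 2X]` with
`ε ≤ |w(X)⁻¹ Σ_{(x, x+w(X)]} μ - X⁻¹ Σ_{(X, 2X]} μ|` is `o(X)`. Stated through any real arithmetic
function `F` agreeing with `μ` pointwise (applied with the coercion of
`ArithmeticFunction.moebius` to `ArithmeticFunction ℝ`, multiplicative by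
`ArithmeticFunction.isMultiplicative_moebius.intCast`). -/
theorem topDigitsMu_badCount (F : ArithmeticFunction ℝ) (hFm : F.IsMultiplicative)
    (hF : ∀ n : ℕ, F n = ((ArithmeticFunction.moebius n : ℤ) : ℝ)) (w : ℕ → ℕ)
    (hw : Tendsto w atTop atTop) (hwX : ∀ X, w X ≤ X) (ε : ℝ) (hε : 0 < ε) :
    (fun X : ℕ => (#{x ∈ Icc X (2 * X) | ε ≤ |(w X : ℝ)⁻¹
        * ∑ n ∈ Ioc x (x + w X), ((ArithmeticFunction.moebius n : ℤ) : ℝ)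
          - (X : ℝ)⁻¹ * ∑ n ∈ Ioc X (2 * X), ((ArithmeticFunction.moebius n : ℤ) : ℝ)|} : ℝ))
      =o[atTop] fun X => (X : ℝ) := by
  have hF1 : ∀ n : ℕ, |F n| ≤ 1 := fun n => by
    rw [hF]
    exact_mod_cast ArithmeticFunction.abs_moebius_le_one
  have hMR := Literature.NumberTheory.Sieve.matomaki_radziwill_holds F hFm hF1 w hw hwX ε hε
  simp only [hF] at hMR
  exact hMR

/-- **Aligned blocks for a general `1`-bounded summand** (twin of `stub_alignedBlocks`). If `a`
has few bad short windows in the sense of Matomäki–Radziwiłł (`hbad`: for every window length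
`w(X) → ∞`, `w(X) ≤ X`, and `ε > 0`, the number of `x ∈ [X, 2X]` with
`ε ≤ |w(X)⁻¹ Σ_{(x,x+w(X)]} a - X⁻¹ Σ_{(X,2X]} a|` is `o(X)`) and mean `→ 0` on `(X, 2X]`
(`hmean`), then for every scale `s j ≤ j`, `s j → ∞` and every `η > 0`: eventually in `j`,
`Σ_{i < 2^{j - s j}} |Σ_{N ∈ [2^j + i 2^{s j}, 2^j + (i+1) 2^{s j})} a N| ≤ η 2^j`. Window averaging
(`stub_windowAverage`, `alignedBlocks_core`) with `h = 2^{⌊s j/2⌋}` and `ε = η/16`. -/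
theorem topDigitsMu_alignedBlocks_of (a : ℕ → ℝ) (ha : ∀ n, |a n| ≤ 1)
    (hbad : ∀ w : ℕ → ℕ, Tendsto w atTop atTop → (∀ X, w X ≤ X) → ∀ ε : ℝ, 0 < ε →
      (fun X : ℕ => (#{x ∈ Icc X (2 * X) | ε ≤ |(w X : ℝ)⁻¹ * ∑ n ∈ Ioc x (x + w X), a n
          - (X : ℝ)⁻¹ * ∑ n ∈ Ioc X (2 * X), a n|} : ℝ)) =o[atTop] fun X => (X : ℝ))
    (hmean : ∀ δ : ℝ, 0 < δ → ∀ᶠ X : ℕ in atTop, |(X : ℝ)⁻¹ * ∑ n ∈ Ioc X (2 * X), a n| ≤ δ)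
    (s : ℕ → ℕ) (hs : ∀ j, s j ≤ j) (hs' : Tendsto s atTop atTop) (η : ℝ) (hη : 0 < η) :
    ∀ᶠ j : ℕ in atTop,
      (∑ i ∈ range (2 ^ (j - s j)),
        |∑ N ∈ Ico (2 ^ j + i * 2 ^ s j) (2 ^ j + (i + 1) * 2 ^ s j), a N|) ≤ η * 2 ^ j := by
  have hε : (0 : ℝ) < η / 16 := by positivity
  -- few bad windows for the window function `X ↦ min X 2^{⌊s(log₂ X)/2⌋}`
  have hMR := hbad (fun X => min X (2 ^ (s (Nat.log 2 X) / 2))) (alignedBlocks_window_tendsto s hs')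
    (fun X => min_le_left _ _) (η / 16) hε
  have h2pow : Tendsto (fun n : ℕ => 2 ^ n) atTop atTop :=
    tendsto_pow_atTop_atTop_of_one_lt one_lt_two
  have hbad' := h2pow.eventually (hMR.def hε)
  have hmean' : ∀ᶠ j : ℕ in atTop, |((2 ^ j : ℕ) : ℝ)⁻¹
      * ∑ n ∈ Ioc (2 ^ j) (2 * 2 ^ j), a n| ≤ η / 16 :=
    h2pow.eventually (hmean (η / 16) hε)
  -- `⌊s j / 2⌋ → ∞` and `s j - ⌊s j / 2⌋ → ∞`
  have hdiv2 : Tendsto (fun j => s j / 2) atTop atTop := by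
    rw [Filter.tendsto_atTop_atTop]
    intro b
    obtain ⟨J, hJ⟩ := Filter.tendsto_atTop_atTop.mp hs' (2 * b)
    exact ⟨J, fun j hj => by have := hJ j hj; omega⟩
  have hsub : Tendsto (fun j => s j - s j / 2) atTop atTop :=
    tendsto_atTop_mono (fun j => Nat.le_sub_of_add_le (by omega)) hdiv2
  have hw : ∀ᶠ j : ℕ in atTop, 16 / η ≤ ((2 ^ (s j / 2) : ℕ) : ℝ) :=
    (tendsto_natCast_atTop_atTop.comp (h2pow.comp hdiv2)).eventually_ge_atTop (16 / η)
  have ht : ∀ᶠ j : ℕ in atTop, 16 / η ≤ ((2 ^ (s j - s j / 2) : ℕ) : ℝ) :=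
    (tendsto_natCast_atTop_atTop.comp (h2pow.comp hsub)).eventually_ge_atTop (16 / η)
  filter_upwards [hbad', hmean', hw, ht] with j hb hm hw1 ht1
  -- the window length at `X = 2^j` is `h = 2^{⌊s j/2⌋}`
  have hsj := hs j
  have hh0 : min (2 ^ j) (2 ^ (s (Nat.log 2 (2 ^ j)) / 2)) = 2 ^ (s j / 2) := by
    rw [Nat.log_pow one_lt_two j]
    exact min_eq_right (Nat.pow_le_pow_right two_pos (by omega))
  rw [hh0] at hb
  simp only [Real.norm_eq_abs, Nat.abs_cast] at hb
  -- the deterministic core at `X = 2^j`, `H = 2^{s j}`, `h = 2^{⌊s j/2⌋}`, `M = 2^{j - s j}`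
  have hXMH : 2 ^ j + 2 ^ (j - s j) * 2 ^ s j = 2 * 2 ^ j := by
    rw [← pow_add, Nat.sub_add_cancel hsj]
    ring
  have hcore := alignedBlocks_core stub_windowAverage a ha (2 ^ j) (2 ^ s j) (2 ^ (s j / 2))
    (2 ^ (j - s j)) Nat.one_le_two_pow (Nat.pow_le_pow_right two_pos (Nat.div_le_self _ _))
    (Nat.pow_le_pow_right two_pos (by omega)) hXMH (η / 16)
    (((2 ^ j : ℕ) : ℝ)⁻¹ * ∑ n ∈ Ioc (2 ^ j) (2 * 2 ^ j), a n) hε.le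
  -- bookkeeping in `ℝ`
  have hhh : ((2 ^ (s j / 2) : ℕ) : ℝ) * ((2 ^ (s j / 2) : ℕ) : ℝ) ≤ ((2 ^ j : ℕ) : ℝ) := by
    have : 2 ^ (s j / 2) * 2 ^ (s j / 2) ≤ 2 ^ j := by
      rw [← pow_add]
      exact Nat.pow_le_pow_right two_pos (by omega)
    exact_mod_cast this
  have hprod : ((2 ^ (s j / 2) : ℕ) : ℝ) * ((2 ^ (j - s j) : ℕ) : ℝ)
      * ((2 ^ (s j - s j / 2) : ℕ) : ℝ) = ((2 ^ j : ℕ) : ℝ) := by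
    have : 2 ^ (s j / 2) * 2 ^ (j - s j) * 2 ^ (s j - s j / 2) = 2 ^ j := by
      rw [← pow_add, ← pow_add]
      congr 1
      omega
    exact_mod_cast this
  have hX1 : (1 : ℝ) ≤ ((2 ^ j : ℕ) : ℝ) := by exact_mod_cast Nat.one_le_two_pow
  have hhpos : (0 : ℝ) ≤ ((2 ^ (s j / 2) : ℕ) : ℝ) := Nat.cast_nonneg _
  have hMpos : (0 : ℝ) ≤ ((2 ^ (j - s j) : ℕ) : ℝ) := Nat.cast_nonneg _
  -- (1) `2h ≤ (η/8) X`
  have h16 : 16 ≤ ((2 ^ (s j / 2) : ℕ) : ℝ) * η := by rwa [div_le_iff₀ hη] at hw1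
  have p1a : 2 * ((2 ^ (s j / 2) : ℕ) : ℝ) * 16
      ≤ 2 * ((2 ^ (s j / 2) : ℕ) : ℝ) * (((2 ^ (s j / 2) : ℕ) : ℝ) * η) :=
    mul_le_mul_of_nonneg_left h16 (by positivity)
  have p1b : η * (((2 ^ (s j / 2) : ℕ) : ℝ) * ((2 ^ (s j / 2) : ℕ) : ℝ)) ≤ η * ((2 ^ j : ℕ) : ℝ) :=
    mul_le_mul_of_nonneg_left hhh hη.le
  -- (2) `2 (X+1) (ε + |A|) ≤ (η/2) X`
  have p2 : (((2 ^ j : ℕ) : ℝ) + 1) * (η / 16 + |((2 ^ j : ℕ) : ℝ)⁻¹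
      * ∑ n ∈ Ioc (2 ^ j) (2 * 2 ^ j), a n|)
      ≤ (2 * ((2 ^ j : ℕ) : ℝ)) * (η / 8) :=
    mul_le_mul (by linarith) (by linarith [hm]) (by positivity) (by positivity)
  -- (3) `2 h M ≤ (η/8) X`
  have h16' : 16 ≤ ((2 ^ (s j - s j / 2) : ℕ) : ℝ) * η := by rwa [div_le_iff₀ hη] at ht1
  have p3a : ((2 ^ (s j / 2) : ℕ) : ℝ) * ((2 ^ (j - s j) : ℕ) : ℝ) * 16
      ≤ ((2 ^ (s j / 2) : ℕ) : ℝ) * ((2 ^ (j - s j) : ℕ) : ℝ)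
        * (((2 ^ (s j - s j / 2) : ℕ) : ℝ) * η) :=
    mul_le_mul_of_nonneg_left h16' (by positivity)
  have p3b : ((2 ^ (s j / 2) : ℕ) : ℝ) * ((2 ^ (j - s j) : ℕ) : ℝ)
        * (((2 ^ (s j - s j / 2) : ℕ) : ℝ) * η) = η * ((2 ^ j : ℕ) : ℝ) := by
    rw [← hprod]
    ring
  have hfin : ∑ i ∈ range (2 ^ (j - s j)),
      |∑ N ∈ Ico (2 ^ j + i * 2 ^ s j) (2 ^ j + (i + 1) * 2 ^ s j), a N|
        ≤ η * ((2 ^ j : ℕ) : ℝ) := by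
    linarith [hcore, hb, p1a, p1b, p2, p3a, p3b, hX1]
  have hXr : ((2 ^ j : ℕ) : ℝ) = (2 : ℝ) ^ j := by push_cast; ring
  rw [hXr] at hfin
  exact hfin

/-- **Aligned blocks for `μ`** (twin of `stub_alignedBlocks`): for every scale `s j ≤ j`,
`s j → ∞`, and every `η > 0`, eventually in `j`, the `2^{j - s j}` aligned blocks of length
`2^{s j}` tiling `[2^j, 2^{j+1})` satisfy `Σ_i |Σ_{B_i} μ| ≤ η 2^j`. From
`topDigitsMu_alignedBlocks_of` with the Matomäki–Radziwiłł theorem for `μ` (`topDigitsMu_badCount`)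
and the prime number theorem for `μ` (`topDigitsMu_mean`). -/
theorem topDigitsMu_alignedBlocks (s : ℕ → ℕ) (hs : ∀ j, s j ≤ j) (hs' : Tendsto s atTop atTop)
    (η : ℝ) (hη : 0 < η) :
    ∀ᶠ j : ℕ in atTop,
      (∑ i ∈ range (2 ^ (j - s j)),
        |∑ N ∈ Ico (2 ^ j + i * 2 ^ s j) (2 ^ j + (i + 1) * 2 ^ s j),
          ((ArithmeticFunction.moebius N : ℤ) : ℝ)|) ≤ η * 2 ^ j :=
  topDigitsMu_alignedBlocks_of (fun n => ((ArithmeticFunction.moebius n : ℤ) : ℝ))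
    (fun n => by exact_mod_cast ArithmeticFunction.abs_moebius_le_one)
    (topDigitsMu_badCount
      ((ArithmeticFunction.moebius : ArithmeticFunction ℤ) : ArithmeticFunction ℝ)
      ArithmeticFunction.isMultiplicative_moebius.intCast (fun _ => rfl))
    topDigitsMu_mean s hs hs' η hη

/-- One aligned block, general summand: since `⌊N / 2^T⌋` is constant on
`[2^j + i 2^t, 2^j + (i+1) 2^t)` (`t ≤ j`, `t ≤ T`; `topDigits_div_const`), the twisted block sum
has the modulus of the plain block sum of `a`. -/
theorem topDigitsMu_block (a : ℕ → ℝ) (G : ℕ → Bool) {j t T : ℕ} (htj : t ≤ j) (htT : t ≤ T)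
    (i : ℕ) :
    |∑ N ∈ Ico (2 ^ j + i * 2 ^ t) (2 ^ j + (i + 1) * 2 ^ t), a N * sgn (G (N / 2 ^ T))|
      = |∑ N ∈ Ico (2 ^ j + i * 2 ^ t) (2 ^ j + (i + 1) * 2 ^ t), a N| := by
  have h : ∀ N ∈ Ico (2 ^ j + i * 2 ^ t) (2 ^ j + (i + 1) * 2 ^ t),
      a N * sgn (G (N / 2 ^ T)) = a N * sgn (G ((2 ^ (j - t) + i) / 2 ^ (T - t))) := by
    intro N hN
    rw [Finset.mem_Ico] at hN
    rw [topDigits_div_const htj htT hN.1 hN.2]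
  have hsgn : ∀ b : Bool, |sgn b| = 1 := fun b => by cases b <;> simp [sgn]
  rw [Finset.sum_congr rfl h, ← Finset.sum_mul, abs_mul, hsgn, mul_one]

/-- One dyadic generation, general summand: if the aligned blocks of length `2^t` (`t ≤ j`,
`t ≤ T`) tiling `[2^j, 2^{j+1})` satisfy `Σ_i |Σ_{B_i} a| ≤ η 2^j`, then
`|Σ_{N ∈ [2^j, 2^{j+1})} a(N) sgn G(⌊N/2^T⌋)| ≤ η 2^j` (`topDigits_sum_blocks`,
`topDigitsMu_block`). -/
theorem topDigitsMu_generation (a : ℕ → ℝ) (G : ℕ → Bool) {j t T : ℕ} (htj : t ≤ j)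
    (htT : t ≤ T) {η : ℝ}
    (hB : (∑ i ∈ range (2 ^ (j - t)),
        |∑ N ∈ Ico (2 ^ j + i * 2 ^ t) (2 ^ j + (i + 1) * 2 ^ t), a N|) ≤ η * 2 ^ j) :
    |∑ N ∈ Ico (2 ^ j) (2 ^ (j + 1)), a N * sgn (G (N / 2 ^ T))| ≤ η * 2 ^ j := by
  have hsplit : 2 ^ (j + 1) = 2 ^ j + 2 ^ (j - t) * 2 ^ t := by
    rw [← pow_add, Nat.sub_add_cancel htj, pow_succ]; ring
  rw [hsplit, topDigits_sum_blocks]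
  calc |∑ i ∈ range (2 ^ (j - t)), ∑ N ∈ Ico (2 ^ j + i * 2 ^ t) (2 ^ j + (i + 1) * 2 ^ t),
          a N * sgn (G (N / 2 ^ T))|
      ≤ ∑ i ∈ range (2 ^ (j - t)), |∑ N ∈ Ico (2 ^ j + i * 2 ^ t) (2 ^ j + (i + 1) * 2 ^ t),
          a N * sgn (G (N / 2 ^ T))| := Finset.abs_sum_le_sum_abs _ _
    _ = ∑ i ∈ range (2 ^ (j - t)),
          |∑ N ∈ Ico (2 ^ j + i * 2 ^ t) (2 ^ j + (i + 1) * 2 ^ t), a N| :=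
        Finset.sum_congr rfl fun i _ => topDigitsMu_block a G htj htT i
    _ ≤ η * 2 ^ j := hB

/-- **Dyadic assembly, general summand** (twin of `stub_topDigits`). For a `1`-bounded `a` whose
aligned dyadic blocks have cancellation at every admissible scale (`hBlocks`), for `ψ`
non-decreasing and unbounded and every `ε > 0`: eventually in `n`, for every `G : ℕ → Bool`,
`|Σ_{N < 2ⁿ} a(N) sgn G(⌊N / 2^{ψ n}⌋)| ≤ ε 2ⁿ`. Scale `s j = min (ψ j) j`; the `2^{n-L}` lowest
`N` are bounded trivially, and on each aligned block of generation `j ∈ [n - L, n)` the top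
digits are constant (`topDigitsMu_generation`). -/
theorem topDigitsMu_assembly (a : ℕ → ℝ) (ha : ∀ N, |a N| ≤ 1)
    (hBlocks : ∀ s : ℕ → ℕ, (∀ j, s j ≤ j) → Tendsto s atTop atTop → ∀ η : ℝ, 0 < η →
      ∀ᶠ j : ℕ in atTop,
        (∑ i ∈ range (2 ^ (j - s j)),
          |∑ N ∈ Ico (2 ^ j + i * 2 ^ s j) (2 ^ j + (i + 1) * 2 ^ s j), a N|) ≤ η * 2 ^ j)
    (ψ : ℕ → ℕ) (hψ : Monotone ψ) (hψ' : Tendsto ψ atTop atTop) (ε : ℝ) (hε : 0 < ε) :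
    ∀ᶠ n : ℕ in atTop, ∀ G : ℕ → Bool,
      |∑ N ∈ range (2 ^ n), a N * sgn (G (N / 2 ^ ψ n))| ≤ ε * (2 : ℝ) ^ n := by
  obtain ⟨L, hL⟩ := exists_pow_lt_of_lt_one (show (0 : ℝ) < ε / 4 by positivity)
    (show (1 / 2 : ℝ) < 1 by norm_num)
  obtain ⟨j₀, hj₀⟩ := Filter.eventually_atTop.mp (hBlocks (fun j => min (ψ j) j)
    (fun j => min_le_right _ _) (topDigits_tendsto_min hψ') (ε / 2) (by positivity))
  refine Filter.eventually_atTop.mpr ⟨j₀ + L, fun n hn G => ?_⟩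
  have hLn : L ≤ n := le_of_add_le_right hn
  set g : ℕ → ℝ := fun N => a N * sgn (G (N / 2 ^ ψ n)) with hg
  have hg1 : ∀ N, |g N| ≤ 1 := by
    intro N
    have hsgn : |sgn (G (N / 2 ^ ψ n))| = 1 := by cases G (N / 2 ^ ψ n) <;> simp [sgn]
    rw [hg, abs_mul, hsgn, mul_one]
    exact ha N
  have h2n : (0 : ℝ) < 2 ^ n := by positivity
  -- split off the `2^{n-L}` lowest `N`
  have hsplit : ∑ N ∈ range (2 ^ n), g N
      = ∑ N ∈ Ico 0 (2 ^ (n - L)), g N + ∑ N ∈ Ico (2 ^ (n - L)) (2 ^ n), g N := by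
    rw [Finset.range_eq_Ico, Finset.sum_Ico_consecutive _ (Nat.zero_le _)
      (Nat.pow_le_pow_right two_pos (Nat.sub_le n L))]
  -- the low part: at most `2^{n-L} ≤ (ε/4) 2ⁿ` terms of modulus `≤ 1`
  have hlow : |∑ N ∈ Ico 0 (2 ^ (n - L)), g N| ≤ ε / 4 * 2 ^ n := by
    calc |∑ N ∈ Ico 0 (2 ^ (n - L)), g N|
        ≤ ∑ N ∈ Ico 0 (2 ^ (n - L)), |g N| := Finset.abs_sum_le_sum_abs _ _
      _ ≤ ∑ N ∈ Ico 0 (2 ^ (n - L)), (1 : ℝ) := Finset.sum_le_sum fun N _ => hg1 N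
      _ = (2 : ℝ) ^ (n - L) := by simp
      _ = (1 / 2 : ℝ) ^ L * 2 ^ n := by
        rw [← Nat.sub_add_cancel hLn, pow_add, Nat.add_sub_cancel, ← mul_assoc,
          mul_comm _ ((2 : ℝ) ^ L), ← mul_assoc, ← mul_pow]
        norm_num
      _ ≤ ε / 4 * 2 ^ n := mul_le_mul_of_nonneg_right hL.le h2n.le
  -- the high part: generations `j ∈ [n - L, n)`, each contributing at most `(ε/2) 2^j`
  have hhigh : |∑ N ∈ Ico (2 ^ (n - L)) (2 ^ n), g N| ≤ ε / 2 * 2 ^ n := by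
    rw [topDigits_sum_dyadic g (Nat.sub_le n L)]
    calc |∑ j ∈ Ico (n - L) n, ∑ N ∈ Ico (2 ^ j) (2 ^ (j + 1)), g N|
        ≤ ∑ j ∈ Ico (n - L) n, |∑ N ∈ Ico (2 ^ j) (2 ^ (j + 1)), g N| :=
          Finset.abs_sum_le_sum_abs _ _
      _ ≤ ∑ j ∈ Ico (n - L) n, ε / 2 * 2 ^ j := by
        refine Finset.sum_le_sum fun j hj => ?_
        rw [Finset.mem_Ico] at hj
        have hj0 : j₀ ≤ j := by omega
        have htT : min (ψ j) j ≤ ψ n := (min_le_left _ _).trans (hψ hj.2.le)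
        exact topDigitsMu_generation a G (min_le_right _ _) htT (hj₀ j hj0)
      _ = ε / 2 * (2 ^ n - 2 ^ (n - L)) := by
        rw [← Finset.mul_sum, topDigits_geom (Nat.sub_le n L)]
      _ ≤ ε / 2 * 2 ^ n := by
        have h2 : (0 : ℝ) ≤ 2 ^ (n - L) := by positivity
        nlinarith
  calc |∑ N ∈ range (2 ^ n), g N|
      = |∑ N ∈ Ico 0 (2 ^ (n - L)), g N + ∑ N ∈ Ico (2 ^ (n - L)) (2 ^ n), g N| := by rw [hsplit]
    _ ≤ |∑ N ∈ Ico 0 (2 ^ (n - L)), g N| + |∑ N ∈ Ico (2 ^ (n - L)) (2 ^ n), g N| :=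
        abs_add_le _ _
    _ ≤ ε / 4 * 2 ^ n + ε / 2 * 2 ^ n := add_le_add hlow hhigh
    _ ≤ ε * (2 : ℝ) ^ n := by nlinarith

/-- **Stub `stub_topDigits_moebius` (line `Sketch`, v9.1) — `μ` is orthogonal to every Boolean
function of the top digits** (the Möbius twin of `stub_topDigits`; Kalai's `TC⁰` conjecture is
stated for `μ`). For `ψ` non-decreasing and unbounded and every `ε > 0`: eventually in `n`, for
every `G : ℕ → Bool`, `|Σ_{N < 2ⁿ} μ(N) sgn G(⌊N / 2^{ψ n}⌋)| ≤ ε 2ⁿ`. Dyadic assembly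
(`topDigitsMu_assembly`) of the aligned-blocks bound for `μ` (`topDigitsMu_alignedBlocks`:
the Matomäki–Radziwiłł theorem `matomaki_radziwill_holds` for `μ` through the window average
`stub_windowAverage`, and the prime number theorem for `μ`, `abs_sum_moebius_le_logPow`). -/
theorem stub_topDigits_moebius (ψ : ℕ → ℕ) (hψ : Monotone ψ) (hψ' : Tendsto ψ atTop atTop) :
    ∀ ε : ℝ, 0 < ε → ∀ᶠ n : ℕ in atTop, ∀ G : ℕ → Bool,
      |∑ N ∈ Finset.range (2 ^ n), ((ArithmeticFunction.moebius N : ℤ) : ℝ) *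
          sgn (G (N / 2 ^ ψ n))| ≤ ε * (2 : ℝ) ^ n :=
  fun ε hε => topDigitsMu_assembly (fun N => ((ArithmeticFunction.moebius N : ℤ) : ℝ))
    (fun N => by exact_mod_cast ArithmeticFunction.abs_moebius_le_one)
    topDigitsMu_alignedBlocks ψ hψ hψ' ε hε

end Summit.QuantumAdvantage.QuantumAdvantage.Theorems.LiouvilleOrthogonalTC0

end
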